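import Summits.BirchSwinnertonDyer.BirchSwinnertonDyer.Theorems.ManinLocalTwoThreePShiftStepFermatQuotient
import Summits.BirchSwinnertonDyer.BirchSwinnertonDyer.Theorems.ManinLocalTwoThreePShiftStepHeisenberg
import Summits.BirchSwinnertonDyer.Rank1Residual.ManinAdditive.PrimeShiftEqualiserLawEdges
import HarnessLib

/-!
# THE PRIME-GENERIC SHIFT-EQUALISER LAW IS A THEOREM: `K_p(N) = D(N)` for EVERY prime `p` and EVERY level `N`
# (route `ManinLocalTwoThree`, cell bsd-f2-manin; cruxes C2 stmt-BirchSwinnertonDyer-22967 / C3 stmt-…-22968; LEAD seat p1 gen 12; the typer's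
# obligation node `ShiftEqualiser.PrimeShiftInvariantIsDiamond` of `…/ManinAdditive/PrimeShiftEqualiserLaw.lean`, T-p1-g11-2)

ASSEMBLY.  For a prime `p ≥ 5` and every `N ≥ 1`, every additive `φ : Γ₀(N) → ℤ/p` invariant under the `p`-shift
`γ ↦ diag(p,1) γ diag(p,1)⁻¹` on `Γ₀(pN)` is a diamond class (`shiftInvariantIsDiamondAtP_all`), by strong induction down the `p`-adic
tower: `p ∤ N` — p2's Serre-amalgam rigidity (`shiftInvariantIsDiamondAtP_of_not_dvd`); `p ∥ N` — the seat's TRANSFER from the index-`(p+1)`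
stabiliser with the Borel vanishing lemma (`shiftInvariantIsDiamondAtP_prime_mul`); `p² ∣ N` — the seat's DESCENT ENGINE inside
`G₁ = {a² ≡ 1}` + extension along the diagonal (`PShiftEngine.descent`), its one obstruction `φ(P_{2/p}) = φ(P_{1/p})` killed by the
FERMAT-QUOTIENT certificate when `p² ∥ N` (`step_of_not_dvd`) and by the HEISENBERG function on `G₁` (p2's free presentation +
Nielsen–Schreier + Gaschütz) with the two-functional argument when `p³ ∣ N` (`step_of_dvd`).  With the typer's edges (p = 2: p3's G₂
`twoShiftInvariantIsDiamond_holds`; p = 3: the seat's g11 `threeShiftInvariantIsDiamondAt_all`; `primeShiftInvariantIsDiamond_iff_five_le_dvd`):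
**`primeShiftInvariantIsDiamond_holds : ShiftEqualiser.PrimeShiftInvariantIsDiamond`** — the LEAD's census conjecture (HOME/p1/CENSUS-shift-
equaliser-p1-g11.md, 55/55) is a THEOREM of the tree: for every prime `p` and every `N`, `ker(π₁* − π_p*) ⊂ H¹(Γ₀(N), 𝔽_p)` is the diamond
span `Hom((ℤ/N)ˣ, 𝔽_p) ∘ d` — Ihara's lemma with trivial mod-`p` coefficients at every level INCLUDING `p ∣ N`, Eisenstein part included.
HONEST FRAMING: a structure theorem about `Γ₀(N)` (beyond print: the `p ∣ N`, Eisenstein-inclusive equaliser statement is the cell's);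
nothing about BSD, Manin's conjecture, C2 or C3 is proved by it; axioms standard. [cite: DarmonDiamondTaylor1995, Lemma 4.28 (p. 135) (shape only)]
-/

set_option autoImplicit false
set_option linter.dupNamespace false

open scoped MatrixGroups

open CongruenceSubgroup Matrix.SpecialLinearGroup
  Summit.BirchSwinnertonDyer.Rank1Residual.ManinAdditive.NineShiftEqualiser

namespace Summit.BirchSwinnertonDyer.BirchSwinnertonDyer.Theorems.ManinLocalTwoThree

namespace PShiftEngine

open ThreeShiftDescent TwoShift PShiftTransfer
open Summit.BirchSwinnertonDyer.Rank1Residual.ManinAdditive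

variable {p : ℕ} [Fact p.Prime]

/-- **`K_p(N) = D(N)` for every `N ≥ 1`, every prime `p ≥ 5`** (coefficients `ℤ/p`): strong induction down the `p`-adic tower.
[new: assembly of the seat's transfer, engine, Fermat-quotient and Heisenberg steps with p2's base] -/
theorem shiftInvariantIsDiamondAtP_all (h5 : 5 ≤ p) : ∀ N : ℕ, 0 < N → ShiftInvariantIsDiamondAtP p N (ZMod p) := by
  have hp : p.Prime := Fact.out
  have hpK : ((p : ℕ) : ZMod p) = 0 := ZMod.natCast_self p
  intro N
  induction N using Nat.strong_induction_on with
  | _ N ih =>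
    intro hN
    by_cases hpN : p ∣ N
    · obtain ⟨M, rfl⟩ := hpN
      have hM : 0 < M := Nat.pos_of_mul_pos_left hN
      by_cases hpM : p ∣ M
      · obtain ⟨m, rfl⟩ := hpM
        have hm : 0 < m := Nat.pos_of_mul_pos_left hM
        have hlt : p * m < p * (p * m) := by
          have : 1 * (p * m) < p * (p * m) := Nat.mul_lt_mul_of_pos_right (by omega) hM
          simpa using this
        have hbase : ShiftInvariantIsDiamondAtP p (p * m) (ZMod p) := ih (p * m) hlt hM
        by_cases hpm : p ∣ m
        · exact step_of_dvd h5 hm hpm hbase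
        · exact step_of_not_dvd hm hpm hbase
      · exact shiftInvariantIsDiamondAtP_prime_mul hpK h5 hM hpM
    · exact shiftInvariantIsDiamondAtP_of_not_dvd hpK hN hpN

/-- **The typer's schema at every level, `p ≥ 5`**: `ShiftEqualiser.ShiftInvariantIsDiamondAt (ZMod p) p N` for all `N ≥ 1`. [new] -/
theorem shiftInvariantIsDiamondAt_all (h5 : 5 ≤ p) (N : ℕ) (hN : 0 < N) :
    ShiftEqualiser.ShiftInvariantIsDiamondAt (ZMod p) (p : ℤ) N :=
  (shiftInvariantIsDiamondAtP_iff p N (ZMod p)).mp (shiftInvariantIsDiamondAtP_all h5 N hN)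

end PShiftEngine

/-- **THE PRIME-GENERIC SHIFT-EQUALISER LAW `ShiftEqualiser.PrimeShiftInvariantIsDiamond` HOLDS**: for EVERY prime `p` and EVERY
level `N`, every additive `φ : Γ₀(N) → ℤ/p` invariant under the `p`-shift on `Γ₀(pN)` is a diamond class — `K_p(N) = D(N)`.
`p = 2`: p3's G₂; `p = 3`: the seat's E-es-96 at every level; `p ≥ 5`: this file. [new: the LEAD's census conjecture, now a theorem] -/
theorem primeShiftInvariantIsDiamond_holds :
    Summit.BirchSwinnertonDyer.Rank1Residual.ManinAdditive.ShiftEqualiser.PrimeShiftInvariantIsDiamond := by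
  rw [Summit.BirchSwinnertonDyer.Rank1Residual.ManinAdditive.ShiftEqualiser.primeShiftInvariantIsDiamond_iff_five_le_dvd]
  intro p hp h5 N hN _
  haveI : Fact p.Prime := ⟨hp⟩
  exact PShiftEngine.shiftInvariantIsDiamondAt_all h5 N hN

end Summit.BirchSwinnertonDyer.BirchSwinnertonDyer.Theorems.ManinLocalTwoThree
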